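import Summits.Parity.BatemanHorn.Theses.RoughValueTransport

/-!
# Route RoughValueTransport, crux RoughValueLaw (stmt-Parity-11390), line friable-deep-tail
## The registered stub `stub_congruenceCount` (S2c)

This is a `--supports` file of the checked skeleton
`Summits/Parity/BatemanHorn/Cruxes/RoughValueLaw/Lines/friable-deep-tail.lean`: it proves the
registered stub `stub_congruenceCount` (S2c, periodic counting of the joint congruence classes)
verbatim.

For moduli `dᵢ ≥ 1` and arbitrary integer polynomials `fᵢ`, with `L := ∏ dᵢ` and
`ρ := #{r < L : ∀ i, dᵢ ∣ fᵢ(r)}`,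
`|#{1 ≤ n ≤ x : ∀ i, dᵢ ∣ fᵢ(n)} − x·ρ/L| ≤ ρ`.

Proof: the predicate `P(n) :≡ ∀ i, dᵢ ∣ fᵢ(n)` is `L`-periodic (`dᵢ ∣ L` and
`a − b ∣ f(a) − f(b)`, `Polynomial.sub_dvd_eval_sub`), so the statement is an instance of the
generic periodic count `abs_card_filter_Icc_sub_le_of_periodic`: every window `(x, x + L]`
contains exactly `ρ` solutions (`n ↦ n % L` is a bijection onto `range L` respecting `P`), whence
`N(x + L) = N(x) + ρ` and the error `N(x) − xρ/L` is `L`-periodic in `x`; for `x < L` it lies in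
`[−ρ, ρ]` because `0 ≤ N(x) ≤ ρ` and `0 ≤ xρ/L ≤ ρ`.  Mathlib only; no named facts.
-/

noncomputable section

open Filter Finset Polynomial
open scoped BigOperators

namespace Summit.Parity.BatemanHorn.Cruxes.RoughValueLaw.FriableDeepTail

/-! ### Generic periodic counting -/

/-- A window `(x, x + L]` of length `L` contains exactly `#{r < L : P r}` solutions of an
`L`-periodic predicate `P`. [folklore] -/
theorem card_filter_Ioc_eq_of_periodic (P : ℕ → Prop) [DecidablePred P] {L : ℕ} (hL : 0 < L)
    (hper : ∀ n, P n ↔ P (n % L)) (x : ℕ) :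
    #((Ioc x (x + L)).filter P) = #((range L).filter P) := by
  refine card_nbij (fun n => n % L) ?_ ?_ ?_
  · intro n hn
    rw [mem_coe, mem_filter] at hn
    rw [mem_coe, mem_filter, mem_range]
    exact ⟨Nat.mod_lt _ hL, (hper n).1 hn.2⟩
  · intro n hn n' hn' h
    rw [mem_coe, mem_filter, mem_Ioc] at hn hn'
    refine Nat.ModEq.eq_of_abs_lt h ?_
    rw [abs_sub_lt_iff]
    constructor <;> omega
  · intro r hr
    rw [mem_coe, mem_filter, mem_range] at hr
    have h1 := Nat.div_mul_le_self (x + L - r) L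
    have h2 := Nat.lt_div_mul_add (a := x + L - r) hL
    have hmod : (r + (x + L - r) / L * L) % L = r := by
      rw [Nat.add_mul_mod_self_right, Nat.mod_eq_of_lt hr.1]
    refine ⟨r + (x + L - r) / L * L, ?_, hmod⟩
    rw [mem_coe, mem_filter, mem_Ioc]
    refine ⟨⟨by omega, by omega⟩, ?_⟩
    rw [hper, hmod]
    exact hr.2

/-- Splitting `[1, x + L] = [1, x] ∪ (x, x + L]` under a filter. [folklore] -/
theorem card_filter_Icc_add (P : ℕ → Prop) [DecidablePred P] (x L : ℕ) :
    #((Icc 1 (x + L)).filter P) = #((Icc 1 x).filter P) + #((Ioc x (x + L)).filter P) := by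
  have hU : Icc 1 (x + L) = Icc 1 x ∪ Ioc x (x + L) := by
    ext n
    simp only [mem_union, mem_Icc, mem_Ioc]
    omega
  have hD : Disjoint ((Icc 1 x).filter P) ((Ioc x (x + L)).filter P) :=
    disjoint_filter_filter (disjoint_left.2 fun n h1 h2 => by
      rw [mem_Icc] at h1
      rw [mem_Ioc] at h2
      omega)
  rw [hU, filter_union, card_union_of_disjoint hD]

/-- For `x < L`, the solutions in `[1, x]` inject into the solutions in `range L`. [folklore] -/
theorem card_filter_Icc_le_of_lt (P : ℕ → Prop) [DecidablePred P] {x L : ℕ} (hx : x < L) :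
    #((Icc 1 x).filter P) ≤ #((range L).filter P) := by
  refine card_le_card (filter_subset_filter P fun n hn => ?_)
  rw [mem_Icc] at hn
  rw [mem_range]
  omega

/-- **Generic periodic count.**  For an `L`-periodic decidable predicate `P` (`L ≥ 1`) and
`ρ := #{r < L : P r}`, `|#{1 ≤ n ≤ x : P n} − x·ρ/L| ≤ ρ`. [folklore] -/
theorem abs_card_filter_Icc_sub_le_of_periodic (P : ℕ → Prop) [DecidablePred P] {L : ℕ}
    (hL : 0 < L) (hper : ∀ n, P n ↔ P (n % L)) (x : ℕ) :
    |((#((Icc 1 x).filter P) : ℕ) : ℝ) -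
        (x : ℝ) * ((#((range L).filter P) : ℕ) : ℝ) / (L : ℝ)| ≤
      ((#((range L).filter P) : ℕ) : ℝ) := by
  have hLr : (0 : ℝ) < L := by exact_mod_cast hL
  have hblock := card_filter_Ioc_eq_of_periodic P hL hper
  have hbase : ∀ y, y < L → #((Icc 1 y).filter P) ≤ #((range L).filter P) :=
    fun y hy => card_filter_Icc_le_of_lt P hy
  generalize #((range L).filter P) = ρ at hblock hbase ⊢
  have hρ0 : (0 : ℝ) ≤ ρ := Nat.cast_nonneg _
  induction x using Nat.strong_induction_on with
  | _ x ih =>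
    rcases lt_or_ge x L with hx | hx
    · -- base case `x < L`: both quantities lie in `[0, ρ]`
      have h1 : ((#((Icc 1 x).filter P) : ℕ) : ℝ) ≤ ρ := by exact_mod_cast hbase x hx
      have h2 : (0 : ℝ) ≤ ((#((Icc 1 x).filter P) : ℕ) : ℝ) := Nat.cast_nonneg _
      have h3 : (0 : ℝ) ≤ (x : ℝ) * (ρ : ℝ) / (L : ℝ) := by positivity
      have h4 : (x : ℝ) * (ρ : ℝ) / (L : ℝ) ≤ ρ := by
        rw [div_le_iff₀ hLr]
        have hxL : (x : ℝ) ≤ L := by exact_mod_cast hx.le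
        nlinarith
      rw [abs_le]
      constructor <;> linarith
    · -- step: `x = y + L`, `N(y + L) = N(y) + ρ`
      obtain ⟨y, rfl⟩ : ∃ y, x = y + L := ⟨x - L, by omega⟩
      rw [card_filter_Icc_add P y L, hblock y, Nat.cast_add, Nat.cast_add]
      have e : ((y : ℝ) + (L : ℝ)) * (ρ : ℝ) / (L : ℝ) = (y : ℝ) * (ρ : ℝ) / (L : ℝ) + ρ := by
        rw [add_mul, add_div, mul_div_cancel_left₀ (ρ : ℝ) hLr.ne']
      rw [e, add_sub_add_right_eq_sub]
      exact ih y (by omega)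

/-! ### The stub -/

/-- **S2c — CongruenceCount (periodic counting of the joint congruence classes).**  For moduli
`dᵢ ≥ 1` and any polynomials `fᵢ ∈ ℤ[X]`:
`|#{1 ≤ n ≤ x : ∀ i, dᵢ ∣ fᵢ(n)} − x·ρ_f(d⃗)/∏dᵢ| ≤ ρ_f(d⃗)`, where
`ρ_f(d⃗) = #{r < ∏dᵢ : ∀ i, dᵢ ∣ fᵢ(r)}`.  The predicate is `∏dᵢ`-periodic because `dᵢ ∣ ∏dᵢ` and
`a − b ∣ fᵢ(a) − fᵢ(b)` (`Polynomial.sub_dvd_eval_sub`); conclude by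
`abs_card_filter_Icc_sub_le_of_periodic`.  Edge `k = 0`: `∏dᵢ = 1`, `ρ = 1`, count `= x`.
[folklore] -/
theorem stub_congruenceCount :
    ∀ (k : ℕ) (f : Fin k → ℤ[X]) (d : Fin k → ℕ) (x : ℕ), (∀ i, 0 < d i) →
      |((#((Icc 1 x).filter (fun n : ℕ => ∀ i, ((d i : ℕ) : ℤ) ∣ (f i).eval (n : ℤ))) : ℕ) : ℝ) -
          (x : ℝ) * ((#((range (∏ i, d i)).filter
              (fun r : ℕ => ∀ i, ((d i : ℕ) : ℤ) ∣ (f i).eval (r : ℤ))) : ℕ) : ℝ) /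
            ((∏ i, d i : ℕ) : ℝ)| ≤
        ((#((range (∏ i, d i)).filter
            (fun r : ℕ => ∀ i, ((d i : ℕ) : ℤ) ∣ (f i).eval (r : ℤ))) : ℕ) : ℝ) := by
  intro k f d x hd
  have hL : 0 < ∏ i, d i := prod_pos fun i _ => hd i
  refine abs_card_filter_Icc_sub_le_of_periodic
    (fun n : ℕ => ∀ i, ((d i : ℕ) : ℤ) ∣ (f i).eval (n : ℤ)) hL (fun n => ?_) x
  refine forall_congr' fun i => dvd_iff_dvd_of_dvd_sub ?_
  refine dvd_trans ?_ (Polynomial.sub_dvd_eval_sub (n : ℤ) ((n % ∏ i, d i : ℕ) : ℤ) (f i))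
  have h1 : ((d i : ℕ) : ℤ) ∣ ((∏ i, d i : ℕ) : ℤ) :=
    Int.natCast_dvd_natCast.2 (dvd_prod_of_mem d (mem_univ i))
  refine dvd_trans h1 ?_
  rw [Int.natCast_mod]
  exact Int.dvd_self_sub_emod

end Summit.Parity.BatemanHorn.Cruxes.RoughValueLaw.FriableDeepTail

end
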